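import Literature.Probability.RandomPlanarGeometry.OneSidedRestriction
import HarnessLib

/-!
# [LSW] Prop. 8.1 (existence of `P⁺_α` for all `α > 0`), the printed existence half of the Cor. 8.6 input

The named fact `Literature.Probability.RandomPlanarGeometry.exists_isRightRestrictionMeasure_lt_five_eighths`
(`OneSidedRestriction`; the deep leaf through which [LSW] Cor. 8.6, and with it the `α < 5/8`
half of p. 5 result 2, `IsRestrictionMeasure.eq_five_eighths_of_outer_simple`, is reduced in
`RestrictionLeftFillLaw`) is the conjunction, for `0 < α < 5/8`, of two printed statements of

* G. F. Lawler, O. Schramm, W. Werner, *Conformal restriction: the chordal case*, J. Amer. Math.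
  Soc. **16** (2003) 917–955, arXiv:math/0209343 (**[LSW]**), §8:

1. EXISTENCE — **Prop. 8.1** (§8.2), first sentence, verbatim: "The right-sided restriction
   measures `P⁺_α` exist for all `α > 0`." (proved there with reflected Brownian excursions,
   "Reflected Brownian excursions therefore show that for all `α ∈ (0, 1]`, the right-sided
   restriction measure with exponent `α` exists. Taking unions of independent hulls which
   satisfy the right-sided restriction property, yields a realization of another right-sided
   restriction measure (and the exponent add up)"; and again by Thm. 8.4 (p. 37) with
   SLE(8/3, ρ), "when `ρ` spans `(−2, ∞)`, `α` spans `(0, ∞)`");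
2. ASYMMETRY — the first half of the proof of Cor. 8.6 (p. 38) with Thm. 8.4 and Lemma 8.3:
   for `0 < α < 5/8` (`−2 < ρ < 0`), "the probability that `i` ends up eventually to 'the right'
   of the right hand boundary of SLE(8/3, ρ) […] is strictly larger than the corresponding
   quantity for SLE(8/3, 0), which is `1/2` by symmetry", i.e. `P⁺_α{i ∉ K} > 1/2`.

Only 1. is vendored here as a named fact (`Literature.Probability.RandomPlanarGeometry.exists_isRightRestrictionMeasure`):
it is a distinct published result, valid for ALL `α > 0`, with its own proofs (§8.2; G. F. Lawler,
*Conformally Invariant Processes in the Plane* (2005) §9.2, Cor. 9.10 and Prop. 9.13 — the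
Poissonian cloud of excursions hung on `(−∞, 0]`, formalized in `OneSidedExcursionCloudMeasure`
from a two-sided restriction measure of exponent `1`).

Statement 2. is NOT a separate named fact (review of the decomposition, D-0026): stated for every
right-sided restriction measure of exponent `α ∈ (0, 5/8)` it is, by the uniqueness of `P⁺_α`
(§8.1 p. 31, proved: `IsRightRestrictionMeasure.unique`), exactly the second conjunct of the
bundled leaf (`IsRightRestrictionMeasure.one_half_lt_measure_notMem_I_of_lt_five_eighths` below),
it carries the same locator (p. 38), and no printed argument proves it at smaller cost than the
bundled leaf itself: both [LSW] p. 38 (through Thm. 8.4) and Lawler (2005) Cor. 9.11 ("since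
`P⁺_{α+β}` can be obtained from `P⁺_α` and `P⁺_β` by taking unions […] `q(α)` is strictly
increasing […] `q(5/8) = 1/2`. Hence `q(α) < 1/2` for `α < 5/8`") need the existence of
`P⁺_{5/8−α}`, i.e. 1. below `5/8`, and the positivity `q(β) > 0` for small `β`; given these the
bundled leaf follows at once (`IsRightRestrictionMeasure.one_half_lt_measure_notMem_I_of_pos`,
`exists_isRightRestrictionMeasure_lt_five_eighths_of_martingale_of_pos` in
`OneSidedRestrictionProofs`). So the asymmetry stays inside the proof obligation of
`exists_isRightRestrictionMeasure_lt_five_eighths`; this file proves the glue in both directions: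
the bundled leaf from 1. and the asymmetry statement (`exists_isRightRestrictionMeasure_lt_five_eighths_of_facts`),
and conversely the asymmetry for EVERY `P⁺_α` (`…_of_lt_five_eighths`) and 1. for `α < 5/8`
from the bundled leaf. Not in the tree: reflected Brownian excursions, SLE(κ, ρ), Thm. 8.4.
-/

noncomputable section

open Set MeasureTheory

namespace Literature.Probability.RandomPlanarGeometry

/-- NAMED FACT — **[LSW] Proposition 8.1** (§8.2), first sentence, verbatim: "The right-sided
restriction measures `P⁺_α` exist for all `α > 0`." Here `P⁺_α` is a probability measure `Q`
on `Ω₊` with `Q[K ∩ A = ∅] = Φ'_A(0)^α` for all `A ∈ 𝒬₊` (`IsRightRestrictionMeasure α Q`,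
§8.1 p. 31; unique, `IsRightRestrictionMeasure.unique`). Printed proofs: the left filling of a
reflected Brownian excursion with angle `θ = π(1 − α)`, `α ∈ (0, 1]`, and fillings of
independent unions (§8.2, second sentence of the proposition); or `F^{ℝ₊}_ℍ(cl K_∞)` for
SLE(8/3, ρ), `α = (3ρ + 10)(2 + ρ)/32`, `ρ > −2` (Thm. 8.4, p. 37). (For `α ≥ 5/8` also
`F^{ℝ₊}_ℍ` of a sample of `P_α`, §8.1 — `IsRestrictionMeasure.map_leftFillConfig`.)
[cite: LawlerSchrammWerner2003Restriction, Prop. 8.1 (§8.2) and Thm. 8.4 (p. 37)] -/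
def exists_isRightRestrictionMeasure : Prop :=
  ∀ α : ℝ, 0 < α → ∃ Q : Measure RightConfig, IsRightRestrictionMeasure α Q

/-- **The bundled Cor. 8.6 input from its two printed halves**: existence of `P⁺_α` (Prop. 8.1)
and the asymmetry bound `P⁺_α{i ∉ K} > 1/2`, `0 < α < 5/8`, for every right-sided restriction
measure of exponent `α` (the first half of the proof of Cor. 8.6, p. 38, kept as an explicit
hypothesis — it is part of the proof obligation of the bundled leaf, see the module docstring)
give `exists_isRightRestrictionMeasure_lt_five_eighths`.
[cite: LawlerSchrammWerner2003Restriction, Prop. 8.1 (§8.2), Thm. 8.4 (p. 37), proof of Cor. 8.6 (p. 38)] -/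
theorem exists_isRightRestrictionMeasure_lt_five_eighths_of_facts
    (h81 : exists_isRightRestrictionMeasure)
    (h86 : ∀ {α : ℝ} {Q : Measure RightConfig}, IsRightRestrictionMeasure α Q → 0 < α → α < 5 / 8 →
      1 / 2 < Q {K | Complex.I ∉ (K : Set ℂ)}) :
    exists_isRightRestrictionMeasure_lt_five_eighths := fun α hα hlt ↦ by
  obtain ⟨Q, hQ⟩ := h81 α hα
  exact ⟨Q, hQ, h86 hQ hα hlt⟩

/-- **The asymmetry for EVERY `P⁺_α`, `0 < α < 5/8`, from the bundled leaf**, by the uniqueness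
of `P⁺_α` ([LSW] §8.1 p. 31): "the probability that `i` ends up eventually to 'the right' of the
right hand boundary […] is strictly larger than […] `1/2`" (proof of Cor. 8.6, p. 38; Lawler
(2005), proof of Cor. 9.11: "`q(α) < 1/2` for `α < 5/8`", `q(α) = P⁺_α{i ∈ K}`).
[cite: LawlerSchrammWerner2003Restriction, §8.1 p. 31 (uniqueness of P⁺_α) with proof of Cor. 8.6 (p. 38)] -/
theorem IsRightRestrictionMeasure.one_half_lt_measure_notMem_I_of_lt_five_eighths
    (h : exists_isRightRestrictionMeasure_lt_five_eighths) {α : ℝ} {Q : Measure RightConfig}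
    (hQ : IsRightRestrictionMeasure α Q) (hα : 0 < α) (hlt : α < 5 / 8) :
    1 / 2 < Q {K | Complex.I ∉ (K : Set ℂ)} := by
  obtain ⟨Q', hQ', h'⟩ := h _ hα hlt
  rwa [hQ.unique hQ']

/-- And the bundled leaf gives the existence of `P⁺_α` for `0 < α < 5/8`. [cite: LawlerSchrammWerner2003Restriction, Thm. 8.4 (p. 37)] -/
theorem exists_isRightRestrictionMeasure_of_lt_five_eighths
    (h : exists_isRightRestrictionMeasure_lt_five_eighths) {α : ℝ} (hα : 0 < α) (hlt : α < 5 / 8) :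
    ∃ Q : Measure RightConfig, IsRightRestrictionMeasure α Q := by
  obtain ⟨Q, hQ, -⟩ := h α hα hlt
  exact ⟨Q, hQ⟩

end Literature.Probability.RandomPlanarGeometry

end
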